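import Literature.MathematicalPhysics.QuantumFieldTheory.Balaban1983to89.BlockAveraging
import HarnessLib

/-!
# `Balaban1983to89.CentreTwist` — the CENTRE ('t Hooft) twist of a lattice gauge field on Bałaban's tori: an exact symmetry of
every Wilson theory, and its action on holonomies of walks (winding-number law) — bookkeeping toward the centre symmetry of the
continuum-limit points of YM₃ on a three-torus (`T3CentreSymmetry`)

CITATION HEADER (lean-in-tree rule).  Cell `ym3-torus` (HUMAN RULING D-0037, YM ladder rung R3), seat `ym3-torus-p2` (IR-side node, non-triviality
conjunct: HOME/IR-NODE.md §3–4).  Sources: G. 't Hooft, *A property of electric and magnetic flux in non-Abelian gauge theories*, Nucl. Phys. B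
**153** (1979) 141–160 [tHooft1979Flux] §2 (multiplying the link variables crossing a hyperplane of the periodic box by a CENTRE element of the
gauge group leaves the action invariant — the electric `Z_N` symmetry of the pure gauge theory on a torus); L. McLerran, B. Svetitsky, Phys. Lett.
B **98** (1981) 195 [McLerranSvetitsky1981] (the Wilson/Polyakov line winding around a period changes sign under the `Z₂` twist; its expectation is
the order parameter); T. Bałaban, CMP **109** (1987) [Balaban1987RG1] (0.4) p. 253 and (2.17) p. 269 (the block averaging and its symmetries —
the intertwining of the twist with (0.4) is in the companion `CentreTwistBlockAvg`).  Everything here is [folklore]-grade bookkeeping about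
finite products of group elements and the product Haar measure; nothing open is asserted.

WHAT IS PROVED.  §1 `GaugeField.ctwist z μ s U` multiplies by `z` the variables of the bonds in direction `μ` issuing from the hyperplane
`{x_μ = s}`; for CENTRAL `z` every plaquette variable, hence every Wilson action and Boltzmann weight, is invariant (`plaqHol_ctwist`,
`wilsonAction_ctwist`); the product Haar measure is invariant (`measurePreserving_ctwist`, left invariance of Haar factor by factor); hence
the twist is an exact symmetry of every torus expectation, `Missing.IsExpectSymmetry.ctwist` — for EVERY `β`, every level-0 lattice.
§2 THE WINDING LAW: along the walk of a word `w` from `x`, `𝒰(ctwist U) = z^{e} · 𝒰(U)` with the exponent `e = twistExp` computed letter by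
letter (`holAt_ctwist_walk`), and `e = F(a + netDisp_μ w) − F(a)` telescopes through the lattice-periodic staircase `F(t) = ⌊(t − 1 − s)/N⌋`
(`twistExp_eq_floor`); so CLOSED CONTRACTIBLE walks (`netDisp_μ = 0` as an integer) see no twist (`holAt_ctwist_walk_of_netDisp_eq_zero`) and
a closed walk winding `w` times around the `μ`-period picks up `z^{w}` (`holAt_ctwist_walk_of_netDisp_eq_mul`).
-/

noncomputable section

open MeasureTheory

namespace Literature.MathematicalPhysics.QuantumFieldTheory.Balaban1983to89

/-! ## 1. The centre twist: definition, invariance of plaquettes / action / Haar measure, exact expectation symmetry -/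

namespace GaugeField

variable {P : Params} {j : ℕ} {G : Type*}

/-- **THE CENTRE TWIST** `ctwist z μ s U`: multiply by `z` (on the left) the variable of every bond `⟨x, x + e_μ⟩` with `x_μ = s` — the
links crossing the hyperplane between the slices `x_μ = s` and `x_μ = s + 1` of the periodic lattice ('t Hooft's twist by a centre element;
for `z ∈ Z(G)` left/right makes no difference). [cite: tHooft1979Flux, §2] -/
def ctwist [Mul G] (z : G) (μ : Fin P.d) (s : ZMod (P.sitesPerDir j)) (U : GaugeField P j G) : GaugeField P j G :=
  fun b => if b.dir = μ ∧ b.src μ = s then z * U b else U b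

/-- The twist unfolded at a bond. [cite: tHooft1979Flux, §2] -/
theorem ctwist_apply [Mul G] (z : G) (μ : Fin P.d) (s : ZMod (P.sitesPerDir j)) (U : GaugeField P j G) (b : PBond P j) :
    U.ctwist z μ s b = if b.dir = μ ∧ b.src μ = s then z * U b else U b := rfl

section Group

variable [GaugeGroup G] {z : G}

/-- Twisting by `z⁻¹` undoes the twist by `z`. [cite: tHooft1979Flux, §2] -/
theorem ctwist_inv_ctwist (z : G) (μ : Fin P.d) (s : ZMod (P.sitesPerDir j)) (U : GaugeField P j G) :
    (U.ctwist z μ s).ctwist z⁻¹ μ s = U := by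
  funext b
  simp only [ctwist_apply]
  split_ifs with h
  · rw [inv_mul_cancel_left]
  · rfl

/-- Twisting by `z` undoes the twist by `z⁻¹`. [cite: tHooft1979Flux, §2] -/
theorem ctwist_ctwist_inv (z : G) (μ : Fin P.d) (s : ZMod (P.sitesPerDir j)) (U : GaugeField P j G) :
    (U.ctwist z⁻¹ μ s).ctwist z μ s = U := by
  simpa only [inv_inv] using ctwist_inv_ctwist z⁻¹ μ s U

/-- Conjugation by a central element is trivial: `z a b (z c)⁻¹ d⁻¹ = a b c⁻¹ d⁻¹`. [folklore] -/
private theorem central_aux₁ (hz : ∀ g : G, z * g = g * z) (a b c d : G) :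
    z * a * b * (z * c)⁻¹ * d⁻¹ = a * b * c⁻¹ * d⁻¹ := by
  have key : ∀ X : G, z * X * z⁻¹ = X := fun X => by rw [hz X, mul_inv_cancel_right]
  calc z * a * b * (z * c)⁻¹ * d⁻¹ = z * (a * b * c⁻¹) * z⁻¹ * d⁻¹ := by simp only [mul_inv_rev, mul_assoc]
    _ = a * b * c⁻¹ * d⁻¹ := by rw [key]

/-- Conjugation by a central element is trivial: `a (z b) c⁻¹ (z d)⁻¹ = a b c⁻¹ d⁻¹`. [folklore] -/
private theorem central_aux₂ (hz : ∀ g : G, z * g = g * z) (a b c d : G) :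
    a * (z * b) * c⁻¹ * (z * d)⁻¹ = a * b * c⁻¹ * d⁻¹ := by
  have key : ∀ X : G, z * X * z⁻¹ = X := fun X => by rw [hz X, mul_inv_cancel_right]
  calc a * (z * b) * c⁻¹ * (z * d)⁻¹ = a * (z * (b * c⁻¹ * d⁻¹) * z⁻¹) := by simp only [mul_inv_rev, mul_assoc]
    _ = a * b * c⁻¹ * d⁻¹ := by rw [key, ← mul_assoc, ← mul_assoc]

/-- **PLAQUETTE VARIABLES ARE INVARIANT under a CENTRAL twist**: the two `μ`-bonds of a plaquette in a `(μ, ν)`-plane issue from the same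
slice, so the plaquette variable is conjugated by `z`, i.e. unchanged ('t Hooft: the action «does not notice» the twist). [cite: tHooft1979Flux, §2] -/
theorem plaqHol_ctwist (hz : ∀ g : G, z * g = g * z) (μ : Fin P.d) (s : ZMod (P.sitesPerDir j)) (U : GaugeField P j G)
    (p : Plaq P j) : plaqHol (U.ctwist z μ s) p = plaqHol U p := by
  have hne : p.μ ≠ p.ν := ne_of_lt p.hμν
  unfold plaqHol
  simp only [ctwist_apply, Site.shift_apply]
  by_cases h1 : p.μ = μ
  · -- the `μ`-bonds are the first and the third
    have h2 : ¬ (p.ν = μ) := fun h => hne (h1.trans h.symm)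
    have hνμ : ¬ (μ = p.ν) := fun h => h2 h.symm
    simp only [h1, true_and, h2, false_and, if_false, hνμ, if_false]
    by_cases hs : p.src μ = s
    · simp only [hs, if_true]
      exact central_aux₁ hz _ _ _ _
    · simp only [hs, if_false]
  · by_cases h2 : p.ν = μ
    · have hμν : ¬ (μ = p.μ) := fun h => h1 h.symm
      simp only [h1, false_and, if_false, h2, true_and, hμν, if_false]
      by_cases hs : p.src μ = s
      · simp only [hs, if_true]
        exact central_aux₂ hz _ _ _ _
      · simp only [hs, if_false]
    · simp only [h1, h2, false_and, if_false]

/-- **THE WILSON ACTION IS INVARIANT under a central twist** (any plaquette weight). [cite: tHooft1979Flux, §2] -/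
theorem wilsonAction_ctwist (hz : ∀ g : G, z * g = g * z) (w : ℝ) (μ : Fin P.d) (s : ZMod (P.sitesPerDir j))
    (U : GaugeField P j G) : wilsonAction w (U.ctwist z μ s) = wilsonAction w U := by
  unfold wilsonAction
  simp_rw [plaqHol_ctwist hz]

/-- `A(ctwist U) = A(U)` for the unit-weight Wilson action of `Setup`. [cite: tHooft1979Flux, §2] -/
theorem wilsonAction4_ctwist (hz : ∀ g : G, z * g = g * z) (μ : Fin P.d) (s : ZMod (P.sitesPerDir j)) (U : GaugeField P j G) :
    wilsonAction4 (U.ctwist z μ s) = wilsonAction4 U :=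
  wilsonAction_ctwist hz 1 μ s U

variable [MeasurableSpace G] [HaarData G] [MeasurableMul G]

/-- **THE PRODUCT HAAR MEASURE IS INVARIANT under the twist** (left invariance of Haar on the twisted factors, identity on the others;
`measurePreserving_pi`) — the measure half of 't Hooft's symmetry statement. [cite: tHooft1979Flux, §2] -/
theorem measurePreserving_ctwist (z : G) (μ : Fin P.d) (s : ZMod (P.sitesPerDir j)) :
    MeasurePreserving (ctwist (P := P) (j := j) z μ s) (fieldMeasure P j G) (fieldMeasure P j G) := by
  classical
  have hcoe : ctwist (P := P) (j := j) z μ s =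
      fun (U : GaugeField P j G) (b : PBond P j) => (if b.dir = μ ∧ b.src μ = s then (fun g : G => z * g) else id) (U b) := by
    funext U b
    simp only [ctwist_apply]
    split_ifs <;> rfl
  rw [hcoe]
  unfold fieldMeasure
  haveI : IsProbabilityMeasure (HaarData.haar (G := G)) := HaarData.isProb
  refine measurePreserving_pi _ _ fun b => ?_
  split_ifs
  · exact ⟨measurable_const_mul z, HaarData.map_mul_left z⟩
  · exact MeasurePreserving.id _

/-- The twist as a measurable automorphism of configuration space (inverse: the twist by `z⁻¹`). [folklore] -/
def ctwistMEquiv (z : G) (μ : Fin P.d) (s : ZMod (P.sitesPerDir j)) : GaugeField P j G ≃ᵐ GaugeField P j G where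
  toFun := ctwist z μ s
  invFun := ctwist z⁻¹ μ s
  left_inv := ctwist_inv_ctwist z μ s
  right_inv := ctwist_ctwist_inv z μ s
  measurable_toFun := (measurePreserving_ctwist z μ s).measurable
  measurable_invFun := (measurePreserving_ctwist z⁻¹ μ s).measurable

/-- Change of variables `U ↦ ctwist U` in configuration-space integrals (the twist preserves `∏ dU(b)`). [cite: tHooft1979Flux, §2] -/
theorem integral_comp_ctwist (z : G) (μ : Fin P.d) (s : ZMod (P.sitesPerDir j)) (g : GaugeField P j G → ℝ) :
    ∫ U, g (U.ctwist z μ s) ∂fieldMeasure P j G = ∫ U, g U ∂fieldMeasure P j G := by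
  have h : MeasurePreserving (ctwistMEquiv (P := P) (j := j) z μ s) (fieldMeasure P j G) (fieldMeasure P j G) :=
    measurePreserving_ctwist z μ s
  exact h.integral_comp' g

end Group

end GaugeField

namespace Missing

variable {G : Type*} [GaugeGroup G]

/-- The Boltzmann weight is invariant under a central twist. [cite: tHooft1979Flux, §2] -/
theorem boltzmann_ctwist {z : G} (hz : ∀ g : G, z * g = g * z) (P : Params) (β : ℝ) (μ : Fin P.d)
    (s : ZMod (P.sitesPerDir 0)) (U : GaugeField P 0 G) : boltzmann P β (U.ctwist z μ s) = boltzmann P β U := by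
  rw [boltzmann, boltzmann, GaugeField.wilsonAction4_ctwist hz]

variable [MeasurableSpace G] [HaarData G] [MeasurableMul G]

/-- **Torus expectations are invariant under a central twist**: `⟨F ∘ ctwist⟩_{P,β} = ⟨F⟩_{P,β}` for EVERY `F` and every real `β`
('t Hooft's electric centre symmetry of the pure gauge theory in a periodic box). [cite: tHooft1979Flux, §2] -/
theorem expect_ctwist {z : G} (hz : ∀ g : G, z * g = g * z) (P : Params) (β : ℝ) (μ : Fin P.d) (s : ZMod (P.sitesPerDir 0))
    (F : GaugeField P 0 G → ℝ) : expect P β (fun U => F (U.ctwist z μ s)) = expect (G := G) P β F := by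
  unfold expect
  congr 1
  calc ∫ U, F (U.ctwist z μ s) * boltzmann P β U ∂fieldMeasure P 0 G
      = ∫ U, (fun V => F V * boltzmann P β V) (U.ctwist z μ s) ∂fieldMeasure P 0 G := by
        congr 1
        funext U
        simp only [boltzmann_ctwist hz]
    _ = ∫ V, F V * boltzmann P β V ∂fieldMeasure P 0 G :=
        GaugeField.integral_comp_ctwist (G := G) z μ s (fun V => F V * boltzmann P β V)

/-- **The central twist is an exact expectation symmetry** of every Wilson theory on Bałaban's finest torus. [cite: tHooft1979Flux, §2] -/
theorem IsExpectSymmetry.ctwist {z : G} (hz : ∀ g : G, z * g = g * z) {P : Params} {β : ℝ} (μ : Fin P.d)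
    (s : ZMod (P.sitesPerDir 0)) : IsExpectSymmetry (G := G) P β (GaugeField.ctwist z μ s) :=
  fun F => expect_ctwist hz P β μ s F

end Missing

/-! ## 2. The winding law: holonomies of walks in the twisted configuration -/

namespace T4Continuum

open GaugeField

variable {P : Params} {j : ℕ}

/-- THE TWIST EXPONENT of a word read from an integer lift `a` of the `μ`-coordinate of its base: `+1` for each letter `+e_μ` issued from
the slice `s`, `−1` for each letter `−e_μ` arriving at it (the bond `⟨x − e_μ, x⟩` traversed backwards is twisted iff `x_μ − 1 = s`) — the signed
crossing number of the twisted hyperplane. [cite: McLerranSvetitsky1981] -/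
def twistExp (μ : Fin P.d) (s : ZMod (P.sitesPerDir j)) : ℤ → List (Letter P.d) → ℤ
  | _, [] => 0
  | a, (ν, true) :: w =>
      (if ν = μ ∧ ((a : ℤ) : ZMod (P.sitesPerDir j)) = s then 1 else 0) + twistExp μ s (a + if ν = μ then 1 else 0) w
  | a, (ν, false) :: w =>
      (if ν = μ ∧ ((a - 1 : ℤ) : ZMod (P.sitesPerDir j)) = s then -1 else 0) + twistExp μ s (a - if ν = μ then 1 else 0) w

variable {G : Type*} [GaugeGroup G] {z : G}

/-- **THE WINDING LAW, letter by letter**: `𝒰(walk_x w)(ctwist U) = z^{twistExp} · 𝒰(walk_x w)(U)` for central `z`, with the exponent read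
from any integer lift `a` of `x_μ`. [cite: McLerranSvetitsky1981] -/
theorem holAt_ctwist_walk (hz : ∀ g : G, z * g = g * z) (μ : Fin P.d) (s : ZMod (P.sitesPerDir j)) (U : GaugeField P j G) :
    ∀ (w : List (Letter P.d)) (x : Site P j) (a : ℤ), ((a : ℤ) : ZMod (P.sitesPerDir j)) = x μ →
      holAt (U.ctwist z μ s) (walk x w) = z ^ twistExp μ s a w * holAt U (walk x w)
  | [], _, _, _ => by simp [walk, holAt_nil, twistExp]
  | (ν, true) :: w, x, a, ha => by
    have hcomm : ∀ (n : ℤ) (g : G), z ^ n * g = g * z ^ n := fun n g =>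
      (Commute.zpow_left (show Commute z g from hz g) n).eq
    have ha' : (((a + if ν = μ then 1 else 0 : ℤ) : ℤ) : ZMod (P.sitesPerDir j)) = (x.shift ν) μ := by
      rw [Site.shift_apply]
      by_cases h : ν = μ
      · subst h; simp [ha]
      · have h' : ¬ (μ = ν) := fun h' => h h'.symm
        simp [h, h', ha]
    rw [walk, holAt_cons, holAt_cons, holAt_ctwist_walk hz μ s U w (x.shift ν) _ ha', twistExp]
    simp only [↓reduceIte, ctwist_apply]
    have hcond : (ν = μ ∧ x μ = s) ↔ (ν = μ ∧ ((a : ℤ) : ZMod (P.sitesPerDir j)) = s) := by rw [ha]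
    by_cases hc : ν = μ ∧ ((a : ℤ) : ZMod (P.sitesPerDir j)) = s
    · rw [if_pos (hcond.mpr hc), if_pos hc, zpow_add, zpow_one]
      simp only [mul_assoc]
      rw [← mul_assoc (U _), ← hcomm, mul_assoc]
    · rw [if_neg (fun h => hc (hcond.mp h)), if_neg hc, zero_add, ← mul_assoc, ← hcomm, mul_assoc]
  | (ν, false) :: w, x, a, ha => by
    have hcomm : ∀ (n : ℤ) (g : G), z ^ n * g = g * z ^ n := fun n g =>
      (Commute.zpow_left (show Commute z g from hz g) n).eq
    have hzi : ∀ g : G, (z * g)⁻¹ = z ^ (-1 : ℤ) * g⁻¹ := fun g => by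
      rw [mul_inv_rev, zpow_neg, zpow_one, ← (show Commute z⁻¹ g⁻¹ from (show Commute z g from hz g).inv_inv).eq]
    have ha' : (((a - if ν = μ then 1 else 0 : ℤ) : ℤ) : ZMod (P.sitesPerDir j)) = (x.unshift ν) μ := by
      rw [Site.unshift_apply]
      by_cases h : ν = μ
      · subst h; simp [ha]
      · have h' : ¬ (μ = ν) := fun h' => h h'.symm
        simp [h, h', ha]
    rw [walk, holAt_cons, holAt_cons, holAt_ctwist_walk hz μ s U w (x.unshift ν) _ ha', twistExp]
    simp only [Bool.false_eq_true, ↓reduceIte, ctwist_apply]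
    have hcond : (ν = μ ∧ (x.unshift ν) μ = s) ↔ (ν = μ ∧ ((a - 1 : ℤ) : ZMod (P.sitesPerDir j)) = s) := by
      constructor
      · rintro ⟨rfl, h⟩; refine ⟨rfl, ?_⟩; rwa [Site.unshift_apply, if_pos rfl, ← ha, ← Int.cast_one, ← Int.cast_sub] at h
      · rintro ⟨rfl, h⟩; refine ⟨rfl, ?_⟩; rw [Site.unshift_apply, if_pos rfl, ← ha, ← Int.cast_one, ← Int.cast_sub]; exact h
    by_cases hc : ν = μ ∧ ((a - 1 : ℤ) : ZMod (P.sitesPerDir j)) = s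
    · rw [if_pos (hcond.mpr hc), if_pos hc, hzi, zpow_add]
      simp only [mul_assoc]
      rw [← mul_assoc (U _)⁻¹, ← hcomm, mul_assoc]
    · rw [if_neg (fun h => hc (hcond.mp h)), if_neg hc, zero_add, ← mul_assoc, ← hcomm, mul_assoc]

/-! ### The telescoping form of the exponent -/

/-- The lattice-periodic staircase `F(t) = ⌊(t − 1 − s)/N⌋` (number of representatives of the slice `s` strictly below `t`, up to a
constant): `F(a + 1) − F(a) = [a ≡ s (mod N)]` (plumbing for the winding count). [cite: McLerranSvetitsky1981] -/
def sliceFloor (N : ℕ) (s : ZMod N) (t : ℤ) : ℤ := (t - 1 - (s.val : ℤ)) / (N : ℤ)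

/-- Floor division jumps by one exactly at multiples: `(m + 1)/N − m/N = [N ∣ m + 1]` for `N > 0`. [folklore] -/
private theorem ediv_add_one_sub_ediv {N : ℤ} (hN : 0 < N) (m : ℤ) :
    (m + 1) / N - m / N = if N ∣ m + 1 then 1 else 0 := by
  have hN0 : N ≠ 0 := hN.ne'
  obtain ⟨q, r, hr0, hrN, rfl⟩ : ∃ q r : ℤ, 0 ≤ r ∧ r < N ∧ m = N * q + r :=
    ⟨m / N, m % N, Int.emod_nonneg _ hN0, Int.emod_lt_of_pos _ hN, (Int.mul_ediv_add_emod m N).symm⟩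
  have hq : (N * q + r) / N = q := by
    rw [Int.add_comm, Int.add_mul_ediv_left _ _ hN0, Int.ediv_eq_zero_of_lt hr0 hrN, zero_add]
  by_cases h : r + 1 = N
  · have h1 : N * q + r + 1 = N * (q + 1) := by rw [mul_add, mul_one, add_assoc, h]
    rw [h1, hq, Int.mul_ediv_cancel_left _ hN0, if_pos (dvd_mul_right _ _)]
    ring
  · have hlt : r + 1 < N := lt_of_le_of_ne (Int.add_one_le_iff.mpr hrN) h
    have h1 : N * q + r + 1 = N * q + (r + 1) := by ring
    have hq' : (N * q + (r + 1)) / N = q := by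
      rw [Int.add_comm, Int.add_mul_ediv_left _ _ hN0, Int.ediv_eq_zero_of_lt (by linarith) hlt, zero_add]
    rw [h1, hq', hq, sub_self, if_neg]
    intro hd
    have hd' : N ∣ r + 1 := by simpa [Int.add_comm, mul_comm] using (Int.dvd_add_right (dvd_mul_right N q)).mp hd
    exact absurd (Int.le_of_dvd (by linarith) hd') (not_le.mpr hlt)

/-- `F(a+1) − F(a) = [a ≡ s]` for the staircase of the slice `s` (one step of the winding count). [cite: McLerranSvetitsky1981] -/
theorem sliceFloor_add_one_sub {N : ℕ} [NeZero N] (s : ZMod N) (a : ℤ) :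
    sliceFloor N s (a + 1) - sliceFloor N s a = if ((a : ℤ) : ZMod N) = s then 1 else 0 := by
  have hN : (0 : ℤ) < N := by exact_mod_cast Nat.pos_of_ne_zero (NeZero.ne N)
  have h := ediv_add_one_sub_ediv hN (a - 1 - (s.val : ℤ))
  simp only [sliceFloor]
  rw [show a + 1 - 1 - (s.val : ℤ) = a - 1 - (s.val : ℤ) + 1 by ring, h, show a - 1 - (s.val : ℤ) + 1 = a - (s.val : ℤ) by ring]
  congr 1
  rw [← ZMod.intCast_eq_intCast_iff_dvd_sub]
  have hs : (((s.val : ℕ) : ℤ) : ZMod N) = s := by simp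
  rw [hs]
  exact propext eq_comm

/-- Shifting by whole periods moves the staircase by the number of periods: `F(t + w N) = F(t) + w` (a line winding `w` times crosses the
twisted hyperplane `w` times net). [cite: McLerranSvetitsky1981] -/
theorem sliceFloor_add_mul {N : ℕ} [NeZero N] (s : ZMod N) (t w : ℤ) :
    sliceFloor N s (t + w * N) = sliceFloor N s t + w := by
  have hN : (N : ℤ) ≠ 0 := by exact_mod_cast (NeZero.ne N)
  simp only [sliceFloor]
  rw [show t + w * N - 1 - (s.val : ℤ) = t - 1 - (s.val : ℤ) + w * N by ring, Int.add_mul_ediv_right _ _ hN]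

/-- **THE EXPONENT TELESCOPES**: `twistExp a w = F(a + netDisp_μ w) − F(a)` (the net number of signed crossings of the twisted
hyperplane depends only on the endpoints of the lifted path). [cite: McLerranSvetitsky1981] -/
theorem twistExp_eq_sliceFloor [NeZero (P.sitesPerDir j)] (μ : Fin P.d) (s : ZMod (P.sitesPerDir j)) :
    ∀ (w : List (Letter P.d)) (a : ℤ),
      twistExp μ s a w = sliceFloor _ s (a + netDisp w μ) - sliceFloor _ s a
  | [], a => by simp [twistExp, netDisp]
  | (ν, true) :: w, a => by
    rw [twistExp, twistExp_eq_sliceFloor μ s w, netDisp_cons]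
    by_cases h : ν = μ
    · subst h
      simp only [true_and, if_true]
      rw [← sliceFloor_add_one_sub s a]
      ring_nf
    · simp only [h, false_and, if_false, zero_add, add_zero]
  | (ν, false) :: w, a => by
    rw [twistExp, twistExp_eq_sliceFloor μ s w, netDisp_cons]
    by_cases h : ν = μ
    · subst h
      simp only [true_and, if_true, Bool.false_eq_true, if_false]
      have h1 := sliceFloor_add_one_sub s (a - 1)
      rw [sub_add_cancel] at h1
      rw [show (if (((a - 1 : ℤ) : ℤ) : ZMod (P.sitesPerDir j)) = s then (-1 : ℤ) else 0) =
        -(if (((a - 1 : ℤ) : ℤ) : ZMod (P.sitesPerDir j)) = s then (1 : ℤ) else 0) by split_ifs <;> simp, ← h1]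
      ring_nf
    · simp only [h, false_and, if_false, zero_add, sub_zero]

/-- **CLOSED CONTRACTIBLE WALKS SEE NO TWIST**: if the word has zero net `μ`-displacement AS AN INTEGER, the holonomy along its walk
is twist-invariant (every plaquette, every small loop of (0.4), every contractible Wilson loop). [cite: tHooft1979Flux, §2] -/
theorem holAt_ctwist_walk_of_netDisp_eq_zero [NeZero (P.sitesPerDir j)] (hz : ∀ g : G, z * g = g * z) (μ : Fin P.d)
    (s : ZMod (P.sitesPerDir j)) (U : GaugeField P j G) (x : Site P j) {w : List (Letter P.d)} (hw : netDisp w μ = 0) :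
    holAt (U.ctwist z μ s) (walk x w) = holAt U (walk x w) := by
  rw [holAt_ctwist_walk hz μ s U w x ((x μ).val : ℤ) (by simp), twistExp_eq_sliceFloor, hw, add_zero, sub_self, zpow_zero,
    one_mul]

/-- **A WALK WINDING `w` TIMES around the `μ`-period picks up `z^{w}`** (net `μ`-displacement `= w·N` as an integer; the Polyakov /
Wilson line of [McLerranSvetitsky1981] is `w = 1`). [cite: McLerranSvetitsky1981] -/
theorem holAt_ctwist_walk_of_netDisp_eq_mul [NeZero (P.sitesPerDir j)] (hz : ∀ g : G, z * g = g * z) (μ : Fin P.d)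
    (s : ZMod (P.sitesPerDir j)) (U : GaugeField P j G) (x : Site P j) {w : List (Letter P.d)} {wn : ℤ}
    (hw : netDisp w μ = wn * (P.sitesPerDir j : ℤ)) :
    holAt (U.ctwist z μ s) (walk x w) = z ^ wn * holAt U (walk x w) := by
  rw [holAt_ctwist_walk hz μ s U w x ((x μ).val : ℤ) (by simp), twistExp_eq_sliceFloor, hw, sliceFloor_add_mul,
    add_sub_cancel_left]

end T4Continuum

end Literature.MathematicalPhysics.QuantumFieldTheory.Balaban1983to89

end
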